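import Summits.ValiantsHypothesis.ValiantsHypothesis.Theorems.DepthWindowCarrierExtraction
import Summits.ValiantsHypothesis.ValiantsHypothesis.Theorems.DepthWindowCarrierRefresh
import Summits.ValiantsHypothesis.ValiantsHypothesis.Theorems.DepthWindowULPBSchedule

/-!
# Route `DepthWindow` — the carrier round, hence `ULPB₂`

Cone-free theorem (decomp-valiant lens 4, g16→g17) supporting the crux item `HomImmHardTwoOne`
(stmt-ValiantsHypothesis-30635): the round lemma `CarrierRound h` of `DepthWindowULPBReduction.lean`, composed from
level A (`exists_carrierExtraction`: extraction on the small non-carrier letters + the carrier block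
`{κ} ∪ pending`) and level B (`exists_carrierRefresh`: the refresh with the carrier frozen, exporting the
no-overshoot inequality), with the cost certificates read off the two groupings; in the corner `2h < e` (huge
scale) the identity round does it.  Consequences (all the rest was landed before): `LowPathTreesAt 2 402 3`,
`ULPB₂ = UniversalLowTreeBiasAt 2` — EVERY integer word has levelled word trees of depth `2⌊log₂⌊log₂ d⌋⌋ + 3` with
TREE bias (LST's `bias(T_w)`, the path functional) `O(h)` — and the exact slope threshold
`UniversalLowTreeBiasAt C ↔ 2 ≤ C`.  By LST 2022 Thm. 3 (converse direction, in print) the lopsided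
relative-rank method therefore proves nothing super-polynomial for set-multilinear FORMULAS of product-depth
`≥ 2log₂log₂ d + 3` either: LST 2022 Question 1 is answered in the large-depth regime.

* `carrierRound` — `CarrierRound h` for `h ≥ 1`;
* `lowPathTreesAt_two`, `universalLowTreeBiasAt_two`, `universalLowTreeBiasAt_iff` — the consequences.

References: [LimayeSrinivasanTavenas2022] CCC 2022 Question 1, Thm. 3; full version Prop. 17, Lemma 21, Claim 28;
[BhargavDuttaSaxena2024] ACM ToCT 16(4):23, Thm. 2.
-/

-- layout Summits/ValiantsHypothesis/ValiantsHypothesis forces the duplicated namespace component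
set_option linter.dupNamespace false

namespace Summit.ValiantsHypothesis.ValiantsHypothesis.Theorems.DepthWindow.TreeBias

open Finset

variable {n : ℕ}

/-- Quotient by the identity grouping is the word itself. [folklore] -/
theorem quotWord_id (w : Fin n → ℤ) (m : Fin n) : quotWord w id m = w m := by
  simp [quotWord, Finset.filter_eq']

/-- **The carrier round** (`CarrierRound h`, g17 target of NODE-v16). [cite: LimayeSrinivasanTavenas2022, Lemma 21] -/
theorem carrierRound (h : ℕ) (hh : 1 ≤ h) : CarrierRound h := by
  classical
  intro n M v x κ hv1 h5 hM hx hsum hD hI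
  obtain ⟨ℓ, hℓ⟩ : ∃ ℓ, ℓ = M / v := ⟨_, rfl⟩
  obtain ⟨e, he⟩ : ∃ e, e = nxtScaleM M v := ⟨_, rfl⟩
  rw [← he]
  have he_def : e = (2 * v - 1) / ℓ := by rw [he, nxtScaleM, hℓ]
  set P := pendSet x κ v with hPdef
  set A := ∑ i, x i with hA
  have hh0 : (0 : ℤ) ≤ h := Nat.cast_nonneg h
  have hv0 : (0 : ℤ) ≤ v := Nat.cast_nonneg v
  have hM0 : (0 : ℤ) ≤ M := Nat.cast_nonneg M
  have hPmass0 : 0 ≤ ∑ i ∈ P, |x i| := sum_nonneg fun i _ => abs_nonneg _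
  have hxκ : |x κ| ≤ 3 * h := by have := abs_sub_abs_le_abs_sub (x κ) A; linarith
  have hPmass : ∑ i ∈ P, |x i| ≤ 2 * h := by linarith [abs_nonneg (x κ + ∑ i ∈ P, x i - A)]
  have hSD : |x κ + ∑ i ∈ P, x i - A| ≤ 2 * h := by linarith
  have hS3 : |x κ + ∑ i ∈ P, x i| ≤ 3 * h := by
    have := abs_sub_abs_le_abs_sub (x κ + ∑ i ∈ P, x i) A; linarith
  have hκP : κ ∉ P := by simp [hPdef, pendSet]
  have hℓ5 : 5 ≤ ℓ := by rw [hℓ, Nat.le_div_iff_mul_le (by omega)]; linarith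
  have hℓ1 : 1 ≤ ℓ := le_trans (by norm_num) hℓ5
  have hℓv : (ℓ : ℤ) * v ≤ M := by
    have := Nat.div_mul_le_self M v; rw [← hℓ] at this; exact_mod_cast this
  have h2e : 2 * e ≤ v := by rw [he]; exact two_mul_nxtScaleM_le hv1 h5
  have hrc0 : ∀ a, roundCost x id id a = 0 := by
    intro a; simp [roundCost, quotWord, Finset.filter_eq']
  by_cases hcorner : 2 * h < e
  · -- the corner `2h < e`: nothing but the carrier is big at the new scale; identity round
    have hP0 : P = ∅ := by
      rw [hPdef, pendSet]
      refine filter_false_of_mem fun i _ hi => ?_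
      have := hx i hi.1
      have : (v : ℤ) < |x i| := hi.2
      have : ((2 * h : ℕ) : ℤ) < e := by exact_mod_cast hcorner
      push_cast at this; linarith [(by exact_mod_cast h2e : (2 * e : ℤ) ≤ v)]
    have hqf : quotWord (quotWord x id) id = x := funext fun m => by rw [quotWord_id, quotWord_id]
    have hPe : pendSet x κ e = ∅ := by
      rw [pendSet]
      refine filter_false_of_mem fun i _ hi => ?_
      have := hx i hi.1
      have : ((2 * h : ℕ) : ℤ) < e := by exact_mod_cast hcorner
      push_cast at this; linarith [hi.2]
    refine ⟨n, id, Function.surjective_id, fun m => ?_, n, id, Function.surjective_id, fun m => ?_, ?_, ?_,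
      fun b hb => ?_, ?_, ?_, fun a ha => ?_, fun a _ _ => ?_⟩
    · simp only [id_eq, Finset.filter_eq', mem_univ, if_true, sum_singleton]
      by_cases hm : m = κ
      · rw [hm]; linarith
      · linarith [hx m hm]
    · simp only [id_eq, Finset.filter_eq', mem_univ, if_true, sum_singleton, quotWord_id]
      by_cases hm : m = κ
      · rw [hm]; linarith
      · linarith [hx m hm]
    · rw [hqf, hP0, sum_empty, add_zero]; rfl
    · intro a ha; rw [hP0] at ha; simp at ha
    · rw [hqf]; exact hx b hb
    · rw [hqf]; show (∑ b ∈ pendSet x κ e, |x b|) + |x κ + ∑ b ∈ pendSet x κ e, x b - A| ≤ |x κ - A|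
      rw [hPe, sum_empty, sum_empty, zero_add, add_zero]
    · rw [hrc0]; exact hPmass0
    · rw [hrc0]; linarith [abs_nonneg (x κ)]
    · rw [hrc0]; linarith
  -- the main regime `e ≤ 2h`
  rw [not_lt] at hcorner
  set bd := min v (2 * h) with hbd
  have hbdv : bd ≤ v := min_le_left _ _
  have hbd2 : bd ≤ 2 * h := min_le_right _ _
  have hebd : e ≤ bd := le_min (by omega) hcorner
  have hbdv' : (bd : ℤ) ≤ v := by exact_mod_cast hbdv
  have hbd2' : (bd : ℤ) ≤ 2 * h := by exact_mod_cast hbd2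
  -- level A
  obtain ⟨M₁, c₁, hc₁, hCfib, hsmallA, hfrom, hmin⟩ := exists_carrierExtraction x κ v hℓ1
  rw [← he_def] at hmin
  set z := quotWord x c₁ with hz
  set W := univ.filter (fun m => m ≠ c₁ κ) with hW
  have hcκW : c₁ κ ∉ W := by simp [hW]
  have hzκ : z (c₁ κ) = x κ + ∑ i ∈ P, x i := by rw [hz, quotWord, hCfib, sum_insert hκP]
  have hzW : ∀ m ∈ W, |z m| ≤ bd := by
    intro m hm
    obtain ⟨a, haκ, haP, rfl⟩ := hfrom m (mem_filter.1 hm).2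
    obtain ⟨_, hav, hfa⟩ := hsmallA a haκ haP
    rcases hfa with hs | ⟨hsm, _⟩
    · have : z (c₁ a) = x a := by rw [hz, quotWord, hs, sum_singleton]
      rw [this, hbd, Nat.cast_min]
      exact le_min hav (by push_cast; exact hx a haκ)
    · have h1 := abs_le_div_of_mul_abs_lt hℓ1 hsm
      rw [← he_def] at h1
      exact h1.trans (by exact_mod_cast hebd)
  have hminM : ∑ j ∈ W.filter (fun j => (e : ℤ) < z j), z j ≤ M ∨
      -(∑ j ∈ W.filter (fun j => z j < -(e : ℤ)), z j) ≤ M := by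
    rcases hmin with h1 | h1
    · left; linarith
    · right; linarith
  -- level B
  obtain ⟨L₂, hidem₂, hout₂, hmass₂, hval₂, hover₂⟩ :=
    exists_carrierRefresh z W (v := bd) (e := e) (M := M) hzW hminM
  obtain ⟨M₂, c₂, rep₂, hc₂, hrep₂, hciff₂, hsum₂⟩ := exists_quotient_of_leader L₂ hidem₂
  have hrepc₂ : ∀ m, rep₂ (c₂ m) = L₂ m := fun m => ((hciff₂ m (c₂ m)).1 rfl).symm
  have hcrep₂ : ∀ b, c₂ (rep₂ b) = b := fun b => (hciff₂ _ _).2 (hrep₂ b)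
  have hfibre₂ : ∀ m, univ.filter (fun j => c₂ j = c₂ m) = univ.filter (fun j => L₂ j = L₂ m) := by
    intro m; ext j; simp only [mem_filter, mem_univ, true_and, hciff₂, hrepc₂]
  have hfibre₂' : ∀ b, univ.filter (fun j => c₂ j = b) = univ.filter (fun j => L₂ j = rep₂ b) := by
    intro b; ext j; simp only [mem_filter, mem_univ, true_and, hciff₂]
  set y := quotWord z c₂ with hy
  set κ' := c₂ (c₁ κ) with hκ'
  have hL₂κ : L₂ (c₁ κ) = c₁ κ := (hout₂ (c₁ κ) hcκW (c₁ κ)).2 rfl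
  have hfibκ₂ : univ.filter (fun j => L₂ j = c₁ κ) = {c₁ κ} := by
    ext j; simp only [mem_filter, mem_univ, true_and, mem_singleton, hout₂ (c₁ κ) hcκW j]
  have hrepκ' : rep₂ κ' = c₁ κ := by rw [hκ', hrepc₂, hL₂κ]
  have hy_eq : ∀ b, y b = ∑ j ∈ univ.filter (fun j => L₂ j = rep₂ b), z j := fun b => by
    rw [hy, quotWord, hfibre₂']
  have hyκ' : y κ' = x κ + ∑ i ∈ P, x i := by rw [hy_eq, hrepκ', hfibκ₂, sum_singleton, hzκ]
  have hbκ' : ∀ b, b ≠ κ' ↔ rep₂ b ∈ W := by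
    intro b
    rw [hW, mem_filter]
    constructor
    · intro hb; exact ⟨mem_univ _, fun h => hb (by rw [← hcrep₂ b, h, hκ'])⟩
    · intro hb h; exact hb.2 (by rw [h, hrepκ'])
  have hyout : ∀ b, b ≠ κ' → |y b| ≤ bd := by
    intro b hb
    have := hval₂ (rep₂ b) ((hbκ' b).1 hb)
    rw [hrep₂ b] at this; rw [hy_eq]; exact this
  -- transport of sums over the new pending set to the stale leaders of level B
  set St := univ.filter (fun i => i ∈ W ∧ L₂ i = i ∧
    (e : ℤ) < |∑ j ∈ univ.filter (fun j => L₂ j = i), z j|) with hSt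
  have htrans : ∀ G : Fin M₁ → ℤ, ∑ b ∈ pendSet y κ' e, G (rep₂ b) = ∑ i ∈ St, G i := by
    intro G
    rw [pendSet, sum_filter]
    calc ∑ b, (if b ≠ κ' ∧ (e : ℤ) < |y b| then G (rep₂ b) else 0)
        = ∑ b, (fun a => if a ∈ W ∧ (e : ℤ) < |∑ j ∈ univ.filter (fun j => L₂ j = a), z j|
            then G a else 0) (rep₂ b) :=
          sum_congr rfl fun b _ => by simp only [hbκ' b, hy_eq]
      _ = ∑ a ∈ univ.filter (fun a => L₂ a = a), (if a ∈ W ∧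
            (e : ℤ) < |∑ j ∈ univ.filter (fun j => L₂ j = a), z j| then G a else 0) :=
          hsum₂ (fun a => if a ∈ W ∧ (e : ℤ) < |∑ j ∈ univ.filter (fun j => L₂ j = a), z j|
            then G a else 0)
      _ = ∑ i ∈ St, G i := by
          rw [hSt, sum_filter, sum_filter]
          refine sum_congr rfl fun i _ => ?_
          by_cases h1 : L₂ i = i
          · by_cases h2 : i ∈ W ∧ (e : ℤ) < |∑ j ∈ univ.filter (fun j => L₂ j = i), z j|
            · rw [if_pos h1, if_pos h2, if_pos ⟨h2.1, h1, h2.2⟩]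
            · rw [if_pos h1, if_neg h2, if_neg (fun h => h2 ⟨h.1, h.2.2⟩)]
          · rw [if_neg h1, if_neg (fun h => h1 h.2.1)]
  have hWsum : ∑ j ∈ W, z j = A - (x κ + ∑ i ∈ P, x i) := by
    rw [hW, Finset.filter_ne', sum_erase_eq_sub (mem_univ _), hzκ, hz, sum_quotWord]
  refine ⟨M₁, c₁, hc₁, fun m => ?_, M₂, c₂, hc₂, fun m => ?_, hyκ', fun a ha => ?_, fun b hb => ?_, ?_, ?_,
    fun a ha => ?_, fun a haκ haP => ?_⟩
  · -- masses of level A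
    by_cases hm : m = c₁ κ
    · rw [hm, hCfib, sum_insert hκP]; linarith
    · obtain ⟨a, haκ, haP, rfl⟩ := hfrom m hm
      obtain ⟨_, hav, hfa⟩ := hsmallA a haκ haP
      rcases hfa with hs | ⟨_, hmass⟩
      · rw [hs, sum_singleton]; linarith [hx a haκ]
      · linarith [(by exact_mod_cast hM : (M : ℤ) ≤ 32 * h)]
  · -- masses of level B
    rw [hfibre₂']
    by_cases hm : m = κ'
    · rw [hm, hrepκ', hfibκ₂, sum_singleton]
      show |z (c₁ κ)| ≤ 128 * (h : ℤ)
      rw [hzκ]; linarith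
    · have := hmass₂ (rep₂ m) ((hbκ' m).1 hm)
      rw [hrep₂ m] at this
      show ∑ j ∈ univ.filter (fun j => L₂ j = rep₂ m), |z j| ≤ 128 * (h : ℤ)
      linarith [(by exact_mod_cast hM : (M : ℤ) ≤ 32 * h)]
  · -- pending letters sit in the carrier block
    have : a ∈ univ.filter (fun j => c₁ j = c₁ κ) := by rw [hCfib]; exact mem_insert_of_mem ha
    show c₂ (c₁ a) = c₂ (c₁ κ); rw [(mem_filter.1 this).2]
  · -- the other outputs are `≤ 2h`
    exact (hyout b hb).trans hbd2'
  · -- no overshoot at the new scale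
    have h1 : ∑ b ∈ pendSet y κ' e, |y b| = ∑ i ∈ St, |∑ j ∈ univ.filter (fun j => L₂ j = i), z j| := by
      rw [← htrans (fun i => |∑ j ∈ univ.filter (fun j => L₂ j = i), z j|)]
      exact sum_congr rfl fun b _ => by rw [hy_eq]
    have h2 : ∑ b ∈ pendSet y κ' e, y b = ∑ i ∈ St, ∑ j ∈ univ.filter (fun j => L₂ j = i), z j := by
      rw [← htrans (fun i => ∑ j ∈ univ.filter (fun j => L₂ j = i), z j)]
      exact sum_congr rfl fun b _ => by rw [hy_eq]
    rw [h1, h2, show quotWord (quotWord x c₁) c₂ (c₂ (c₁ κ)) = x κ + ∑ i ∈ P, x i from hyκ']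
    rw [hWsum] at hover₂
    rw [show x κ + ∑ i ∈ P, x i + ∑ i ∈ St, ∑ j ∈ univ.filter (fun j => L₂ j = i), z j - A =
        -((A - (x κ + ∑ i ∈ P, x i)) - ∑ i ∈ St, ∑ j ∈ univ.filter (fun j => L₂ j = i), z j) by ring,
      abs_neg, abs_sub_comm (x κ + ∑ i ∈ P, x i) A]
    exact hover₂
  · -- cost of the carrier
    rw [roundCost, hCfib, sum_insert hκP, hfibre₂, hL₂κ, hfibκ₂, sum_singleton]
    linarith
  · -- cost of a pending node
    have hca : c₁ a = c₁ κ := by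
      have : a ∈ univ.filter (fun j => c₁ j = c₁ κ) := by rw [hCfib]; exact mem_insert_of_mem ha
      exact (mem_filter.1 this).2
    rw [roundCost, hca, hCfib, sum_insert hκP, hfibre₂, hL₂κ, hfibκ₂, sum_singleton]
    linarith [abs_nonneg (x a)]
  · -- cost of a small node
    obtain ⟨hne, hav, hfa⟩ := hsmallA a haκ haP
    have hW₁ : c₁ a ∈ W := by rw [hW, mem_filter]; exact ⟨mem_univ _, hne⟩
    have hB : ∑ j ∈ univ.filter (fun j => L₂ j = L₂ (c₁ a)), |quotWord x c₁ j| ≤ 2 * M + 2 * bd :=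
      hmass₂ (c₁ a) hW₁
    have hA1 : (∑ j ∈ univ.filter (fun j => c₁ j = c₁ a), |x j|) - |x a| ≤ M := by
      rcases hfa with hs | ⟨_, hmass⟩
      · rw [hs, sum_singleton]; linarith
      · linarith [abs_nonneg (x a)]
    rw [roundCost, hfibre₂]
    linarith [abs_nonneg (quotWord x c₁ (c₁ a))]

/-- **Uniform low-path trees at slope 2**: `LowPathTreesAt 2 402 3`. [cite: LimayeSrinivasanTavenas2022, Question 1] -/
theorem lowPathTreesAt_two : LowPathTreesAt 2 402 3 :=
  lowPathTreesAt_two_of_carrierRound carrierRound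

/-- **`ULPB₂`**: every integer word has, at every depth `Δ ≥ 2⌊log₂⌊log₂ d⌋⌋ + 3`, a levelled word tree with TREE
bias `≤ 804·h` (`UniversalLowTreeBiasAt 2`).  LST 2022 Question 1, large-depth regime: `max_w bias` is bounded
there, so the lopsided relative-rank method gives no super-polynomial set-multilinear FORMULA lower bound for
`IMM` at product-depth `≥ 2log₂log₂ d + 3` (LST 2022 Thm. 3, converse direction).
[cite: LimayeSrinivasanTavenas2022, Question 1, Thm. 3] -/
theorem universalLowTreeBiasAt_two : UniversalLowTreeBiasAt 2 :=
  universalLowTreeBiasAt_two_of_carrierRound carrierRound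

/-- **The slope threshold for uniform low TREE bias is exactly 2**: `UniversalLowTreeBiasAt C ↔ 2 ≤ C`
(lower side: BDS 2024 Thm. 2 golden words, landed as `not_universalLowTreeBiasAt_one`).
[cite: BhargavDuttaSaxena2024, Theorem 2] -/
theorem universalLowTreeBiasAt_iff (C : ℕ) : UniversalLowTreeBiasAt C ↔ 2 ≤ C :=
  universalLowTreeBiasAt_iff_of_carrierRound carrierRound C

end Summit.ValiantsHypothesis.ValiantsHypothesis.Theorems.DepthWindow.TreeBias
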